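import Summits.CriticalPhenomena.PercolationContinuityZ3.Theorems.PercNearOneGluingNoHeavyLowerTailSahiTriangleStaircaseTwoAtoms
import Mathlib.Tactic.Linarith
import Mathlib.Tactic.Ring
import Mathlib.Tactic.Positivity
import HarnessLib

/-!
# `NoHeavyLowerTail` (crux stmt-CriticalPhenomena-4575), P2 — the general two-step member: the HARD-CASE identity and `Bounds ⇒ E3 ≥ 0`

Memo SAHI-ROUTE.md §4.23(g) (seat `prim-masterthm-p2`, gen 7; `--supports stmt-CriticalPhenomena-4575`).  Pure real algebra on top of
`…SahiTriangleStaircaseTwoAtoms` (`Atoms`, `Atoms.Bounds`, identities A/B, the swap, the free cases).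

The piece missing there was the corner `min(P₁,Q₂) > P₁Q₁ + P₂Q₂`, where NO certificate with multipliers depending on `(P,Q)` alone exists
(the products of means `S_xS_y` form a rank-one matrix, which such certificates cannot see).  IDENTITY H below is an "entangled" certificate:
its means-level remainder `a₂c₁ + (Q₂/Q₁)(a₁−a₂)S_e + ((Q₁−Q₂)/Q₁)(a₁−a₂)c₁` is nonnegative only in the HARD CASE `a₂ ≤ a₁`
(`a_i = E[A_i]`, `c_j = E[C_j]`); the complementary case `a₁ ≤ a₂` is the free case `E3_nonneg_of_EA_le`.  Identity H is valid on
`P₁Q₁ ≤ (1−P₂)Q₂`, exactly the complement of the region `Q₂ ≤ P₁Q₁ + P₂Q₂` of identities A ∪ B.  Hence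
**`Atoms.E3_nonneg`: `Bounds ∧ 0 < P₁ ∧ P₂ < 1 ∧ 0 < Q₁ ⇒ 0 ≤ E3`** (and the swapped variant `E3_nonneg'`).  The member-level corollary —
Sahi's `C_3` for every non-degenerate two-step staircase member of class T — is in `…SahiTriangleStaircaseTwoFull`.
Identity found by exact LP with ray-positivity constraints on the hard-case mean cones and verified symbolically (code/gen7/gen2ent.py,
gen2entfit.py, gen2B.py, gen2lean.py).
-/

namespace Summit.CriticalPhenomena.PercolationContinuityZ3.Theorems

namespace SahiTriangleStaircaseTwo

namespace Atoms

variable (z : Atoms)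

/-- IDENTITY H (hard case): `Q₁(1−P₂)·E3` = eleven signed atom products + the means-level remainder
`Q₁(1−P₂)a₂c₁ + (1−P₂)Q₂(a₁−a₂)S_e + (1−P₂)(Q₁−Q₂)(a₁−a₂)c₁`. [this work] -/
theorem identityH : z.Q1 * (1 - z.P2) * z.E3 =
    (1 - z.P2) * (z.Q1 + (z.P2 - z.P1) * (z.Q1 - z.Q2)) * (z.Smu - z.Sm * z.Su)
    + z.Q1 * (1 - z.P2) * (z.Sme - z.Sm * z.Se)
    + (1 - z.P2) * (z.Q2 + (z.P2 - z.P1) * (z.Q1 - z.Q2)) * (z.Sdu - z.Sd * z.Su)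
    + (1 - z.P2) * ((z.P2 - z.P1) * (z.Q1 - z.Q2)) * (z.Snu - z.Sn * z.Su)
    + (1 - z.P2) * (z.Q1 - z.Q2) * z.EA1e + (1 - z.P2) * z.Q2 * z.EA1C1
    + ((1 - z.P2) * ((z.Q1 - z.Q2) + z.Q1 * z.Q2) + z.P1 * z.Q1 * (1 - z.Q1)) * z.EA2u
    + z.Q1 * ((1 - z.P2) * z.Q2 + z.P1 * (1 - z.Q1)) * z.EA2e
    + z.Q1 * ((1 - z.P2) * z.Q2 - z.P1 * z.Q1) * z.EA2t
    + z.P1 * z.Q1 * z.EnC1 + z.Q1 * (1 - z.P2) * z.EdC2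
    + z.Q1 * (1 - z.P2) * (z.EA2 * z.EC1) + (1 - z.P2) * z.Q2 * ((z.EA1 - z.EA2) * z.Se)
    + (1 - z.P2) * (z.Q1 - z.Q2) * ((z.EA1 - z.EA2) * z.EC1) := by
  simp only [E3, EA1e, EA1C1, EA2u, EA2e, EA2t, EnC1, EdC2, EA2, EC1, EA1]; ring

variable {z}

/-- Region H, hard case: `a₂ ≤ a₁`, `P₁Q₁ ≤ (1−P₂)Q₂` (with `Q₁ > 0`, `P₂ < 1`) ⇒ `E3 ≥ 0`. [this work] -/
theorem E3_nonneg_of_regionH (h : z.Bounds) (hQ1 : 0 < z.Q1) (hP2 : z.P2 < 1) (ha : z.EA2 ≤ z.EA1)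
    (hreg : z.P1 * z.Q1 ≤ (1 - z.P2) * z.Q2) : 0 ≤ z.E3 := by
  have hP1 := h.hP1; have hP12 := h.hP12; have hQ2 := h.hQ2; have hQ21 := h.hQ21; have hQ1' := h.hQ1
  have hS : 0 ≤ 1 - z.P2 := by linarith
  have hR : 0 ≤ z.P2 - z.P1 := by linarith
  have hRq : 0 ≤ z.Q1 - z.Q2 := by linarith
  have hSq : 0 ≤ 1 - z.Q1 := by linarith
  have cmu : 0 ≤ z.Smu - z.Sm * z.Su := by linarith [h.cmu]
  have cme : 0 ≤ z.Sme - z.Sm * z.Se := by linarith [h.cme]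
  have cdu : 0 ≤ z.Sdu - z.Sd * z.Su := by linarith [h.cdu]
  have cnu : 0 ≤ z.Snu - z.Sn * z.Su := by linarith [h.cnu]
  have had : 0 ≤ z.EA1 - z.EA2 := by linarith
  have key : 0 ≤ z.Q1 * (1 - z.P2) * z.E3 := by
    rw [identityH]
    have t1 : 0 ≤ (1 - z.P2) * (z.Q1 + (z.P2 - z.P1) * (z.Q1 - z.Q2)) * (z.Smu - z.Sm * z.Su) := by positivity
    have t2 : 0 ≤ z.Q1 * (1 - z.P2) * (z.Sme - z.Sm * z.Se) := by positivity
    have t3 : 0 ≤ (1 - z.P2) * (z.Q2 + (z.P2 - z.P1) * (z.Q1 - z.Q2)) * (z.Sdu - z.Sd * z.Su) := by positivity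
    have t4 : 0 ≤ (1 - z.P2) * ((z.P2 - z.P1) * (z.Q1 - z.Q2)) * (z.Snu - z.Sn * z.Su) := by positivity
    have t5 : 0 ≤ (1 - z.P2) * (z.Q1 - z.Q2) * z.EA1e := by have := h.a1e; positivity
    have t6 : 0 ≤ (1 - z.P2) * z.Q2 * z.EA1C1 := by have := h.a1c1; positivity
    have t7 : 0 ≤ ((1 - z.P2) * ((z.Q1 - z.Q2) + z.Q1 * z.Q2) + z.P1 * z.Q1 * (1 - z.Q1)) * z.EA2u := by
      have := h.a2u; positivity
    have t8 : 0 ≤ z.Q1 * ((1 - z.P2) * z.Q2 + z.P1 * (1 - z.Q1)) * z.EA2e := by have := h.a2e; positivity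
    have t9 : 0 ≤ z.Q1 * ((1 - z.P2) * z.Q2 - z.P1 * z.Q1) * z.EA2t :=
      mul_nonneg (mul_nonneg hQ1.le (by linarith)) h.a2t
    have t10 : 0 ≤ z.P1 * z.Q1 * z.EnC1 := by have := h.c1n; positivity
    have t11 : 0 ≤ z.Q1 * (1 - z.P2) * z.EdC2 := by have := h.c2d; positivity
    have t12 : 0 ≤ z.Q1 * (1 - z.P2) * (z.EA2 * z.EC1) := by have := h.ea2; have := h.ec1; positivity
    have t13 : 0 ≤ (1 - z.P2) * z.Q2 * ((z.EA1 - z.EA2) * z.Se) := by have := h.se; positivity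
    have t14 : 0 ≤ (1 - z.P2) * (z.Q1 - z.Q2) * ((z.EA1 - z.EA2) * z.EC1) := by have := h.ec1; positivity
    linarith
  nlinarith [key, mul_pos hQ1 (sub_pos.mpr hP2)]

/-- **THEOREM (atom level, general two-step).** `Bounds ∧ 0 < P₁ ∧ P₂ < 1 ∧ 0 < Q₁ ⇒ 0 ≤ E3`.  Cases: `a₁ ≤ a₂` (free case);
else `P₁Q₁ ≤ (1−P₂)Q₂` (identity H) or `Q₂ ≤ P₁Q₁ + P₂Q₂` (identities A, B). [this work] -/
theorem E3_nonneg (h : z.Bounds) (hP1 : 0 < z.P1) (hP2 : z.P2 < 1) (hQ1 : 0 < z.Q1) : 0 ≤ z.E3 := by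
  rcases le_total z.EA1 z.EA2 with ha | ha
  · exact E3_nonneg_of_EA_le h ha
  rcases le_total (z.P1 * z.Q1) ((1 - z.P2) * z.Q2) with hreg | hreg
  · exact E3_nonneg_of_regionH h hQ1 hP2 ha hreg
  · exact E3_nonneg_of_Q2_le h hP1 hQ1 (by linarith)

/-- The swapped variant: `Bounds ∧ 0 < Q₂ ∧ Q₁ < 1 ∧ 0 < P₂ ⇒ 0 ≤ E3`. [this work] -/
theorem E3_nonneg' (h : z.Bounds) (hQ2 : 0 < z.Q2) (hQ1 : z.Q1 < 1) (hP2 : 0 < z.P2) : 0 ≤ z.E3 := by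
  rw [← E3_swap]
  exact E3_nonneg h.swap hQ2 hQ1 hP2


/-! ### The degenerate strata and the unconditional atom theorem -/

/-- Stratum `Q₁ = 0` (so `Q₂ = 0`): `E3 = (S_mu+S_me+S_du) + E[A₂u] + E[A₁e] + P₂(κ_mu+κ_du+κ_nu) + P₁(κ_me+κ_de+κ_ne) ≥ 0`. [this work] -/
theorem E3_nonneg_of_Q1_eq_zero (h : z.Bounds) (hQ1 : z.Q1 = 0) : 0 ≤ z.E3 := by
  have hQ2 : z.Q2 = 0 := le_antisymm (h.hQ21.trans_eq hQ1) h.hQ2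
  have key : z.E3 = (z.Smu + z.Sme + z.Sdu) + z.EA2u + z.EA1e
      + z.P2 * ((z.Smu - z.Sm * z.Su) + (z.Sdu - z.Sd * z.Su) + (z.Snu - z.Sn * z.Su))
      + z.P1 * ((z.Sme - z.Sm * z.Se) + (z.Sde - z.Sd * z.Se) + (z.Sne - z.Sn * z.Se)) := by
    simp only [E3, EA2u, EA1e, hQ1, hQ2]; ring
  rw [key]
  have hP2 : 0 ≤ z.P2 := le_trans h.hP1 h.hP12
  have c1 : 0 ≤ (z.Smu - z.Sm * z.Su) + (z.Sdu - z.Sd * z.Su) + (z.Snu - z.Sn * z.Su) := by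
    linarith [h.cmu, h.cdu, h.cnu]
  have c2 : 0 ≤ (z.Sme - z.Sm * z.Se) + (z.Sde - z.Sd * z.Se) + (z.Sne - z.Sn * z.Se) := by
    linarith [h.cme, h.cde, h.cne]
  have := h.smu; have := h.sme; have := h.sdu; have := h.a2u; have := h.a1e
  have := mul_nonneg hP2 c1; have := mul_nonneg h.hP1 c2
  linarith

/-- Stratum `P₁ = 0, Q₂ = 0`: `E3 = (Q₁+P₂)κ_mu + Q₁κ_me + Q₁κ_mt + P₂κ_du + P₂κ_nu + S_me + E[mC₁] + S_du + E[A₂u] ≥ 0`. [this work] -/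
theorem E3_nonneg_of_P1_Q2_eq_zero (h : z.Bounds) (hP1 : z.P1 = 0) (hQ2 : z.Q2 = 0) : 0 ≤ z.E3 := by
  have key : z.E3 = (z.Q1 + z.P2) * (z.Smu - z.Sm * z.Su) + z.Q1 * (z.Sme - z.Sm * z.Se) + z.Q1 * (z.Smt - z.Sm * z.St)
      + z.P2 * (z.Sdu - z.Sd * z.Su) + z.P2 * (z.Snu - z.Sn * z.Su) + z.Sme + z.EmC1 + z.Sdu + z.EA2u := by
    simp only [E3, EmC1, EA2u, hP1, hQ2]; ring
  rw [key]
  have hP2 : 0 ≤ z.P2 := le_trans h.hP1 h.hP12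
  have hQ1 : 0 ≤ z.Q1 := le_trans h.hQ2 h.hQ21
  have cmu : 0 ≤ z.Smu - z.Sm * z.Su := by linarith [h.cmu]
  have cme : 0 ≤ z.Sme - z.Sm * z.Se := by linarith [h.cme]
  have cmt : 0 ≤ z.Smt - z.Sm * z.St := by linarith [h.cmt]
  have cdu : 0 ≤ z.Sdu - z.Sd * z.Su := by linarith [h.cdu]
  have cnu : 0 ≤ z.Snu - z.Sn * z.Su := by linarith [h.cnu]
  have := h.sme; have := h.c1m; have := h.sdu; have := h.a2u
  positivity

/-- Stratum `P₁ = 0, Q₁ = 1`: a twelve-term identity, all terms signed. [this work] -/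
theorem E3_nonneg_of_P1_eq_zero_Q1_eq_one (h : z.Bounds) (hP1 : z.P1 = 0) (hQ1 : z.Q1 = 1) : 0 ≤ z.E3 := by
  have key : z.E3 = (2 - z.Q2) * (z.Smu - z.Sm * z.Su) + (1 - z.Q2) * (z.Sme - z.Sm * z.Se) + (1 - z.Q2) * (z.Smt - z.Sm * z.St)
      + (z.Sdu - z.Sd * z.Su) + z.Sme + (1 - z.Q2 + z.P2 * z.Q2) * z.EmC1 + z.Q2 * (1 - z.P2) * z.Sdt + z.EdC2
      + z.P2 * z.Q2 * z.EnC1 + z.Q2 * z.EA2u + z.Q2 * z.EA2e + z.EA2 * z.EC2 := by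
    simp only [E3, EmC1, EdC2, EnC1, EA2u, EA2e, EA2, EC2, hP1, hQ1]; ring
  rw [key]
  have hP2 : 0 ≤ z.P2 := le_trans h.hP1 h.hP12
  have hS : 0 ≤ 1 - z.P2 := by linarith [h.hP2]
  have hQ2 := h.hQ2
  have hSq : 0 ≤ 1 - z.Q2 := by linarith [h.hQ21.trans_eq hQ1]
  have h2q : 0 ≤ 2 - z.Q2 := by linarith
  have hc : 0 ≤ 1 - z.Q2 + z.P2 * z.Q2 := by nlinarith
  have cmu : 0 ≤ z.Smu - z.Sm * z.Su := by linarith [h.cmu]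
  have cme : 0 ≤ z.Sme - z.Sm * z.Se := by linarith [h.cme]
  have cmt : 0 ≤ z.Smt - z.Sm * z.St := by linarith [h.cmt]
  have cdu : 0 ≤ z.Sdu - z.Sd * z.Su := by linarith [h.cdu]
  have := h.sme; have := h.c1m; have := h.sdt; have := h.c2d; have := h.c1n; have := h.a2u; have := h.a2e
  have := h.ea2; have := h.ec2
  positivity

/-- Stratum `P₂ = 1, Q₁ = 1` (the OR corner): a sixteen-term identity, all terms signed. [this work] -/
theorem E3_nonneg_of_P2_Q1_eq_one (h : z.Bounds) (hP2 : z.P2 = 1) (hQ1 : z.Q1 = 1) : 0 ≤ z.E3 := by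
  have key : z.E3 = ((1 - z.P1) * (1 - z.Q2) + 1) * (z.Smu - z.Sm * z.Su) + (1 - z.Q2 * (1 - z.P1)) * (z.Sme - z.Sm * z.Se)
      + (1 - z.P1) * (1 - z.Q2) * (z.Smt - z.Sm * z.St) + (1 - z.P1 * (1 - z.Q2)) * (z.Sdu - z.Sd * z.Su)
      + z.P1 * z.Q2 * (z.Sde - z.Sd * z.Se) + (1 - z.P1) * (1 - z.Q2) * (z.Snu - z.Sn * z.Su)
      + z.EmC1 + z.P1 * (1 - z.Q2) * (z.Sd * z.St) + z.P1 * (1 - z.Q2) * z.EdC1 + z.EdC2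
      + z.Q2 * (1 - z.P1) * (z.Sn * z.Se) + (z.Q2 + z.P1 * (1 - z.Q2)) * (z.Sn * z.St)
      + z.P1 * z.EnC1 + (1 - z.P1) * z.EnC2 + z.EA1e + ((1 - z.P1) * (1 - z.Q2) + 1) * z.EA2u := by
    simp only [E3, EmC1, EdC1, EdC2, EnC1, EnC2, EA1e, EA2u, hP2, hQ1]; ring
  rw [key]
  have hP1 := h.hP1; have hQ2 := h.hQ2
  have hS : 0 ≤ 1 - z.P1 := by linarith [h.hP12.trans_eq hP2]
  have hSq : 0 ≤ 1 - z.Q2 := by linarith [h.hQ21.trans_eq hQ1]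
  have k1 : 0 ≤ 1 - z.Q2 * (1 - z.P1) := by nlinarith
  have k2 : 0 ≤ 1 - z.P1 * (1 - z.Q2) := by nlinarith
  have cmu : 0 ≤ z.Smu - z.Sm * z.Su := by linarith [h.cmu]
  have cme : 0 ≤ z.Sme - z.Sm * z.Se := by linarith [h.cme]
  have cmt : 0 ≤ z.Smt - z.Sm * z.St := by linarith [h.cmt]
  have cdu : 0 ≤ z.Sdu - z.Sd * z.Su := by linarith [h.cdu]
  have cde : 0 ≤ z.Sde - z.Sd * z.Se := by linarith [h.cde]
  have cnu : 0 ≤ z.Snu - z.Sn * z.Su := by linarith [h.cnu]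
  have := h.c1m; have := h.sd; have := h.st; have := h.c1d; have := h.c2d; have := h.sn; have := h.se
  have := h.c1n; have := h.c2n; have := h.a1e; have := h.a2u
  positivity

/-- **THEOREM (atom level, unconditional).** `Bounds ⇒ 0 ≤ E3`: `E3_nonneg` / `E3_nonneg'` in the interior, the four strata lemmas
(and their swaps) on the boundary. [this work] -/
theorem E3_nonneg_all (h : z.Bounds) : 0 ≤ z.E3 := by
  by_cases hQ1z : z.Q1 = 0
  · exact E3_nonneg_of_Q1_eq_zero h hQ1z
  have hQ1 : 0 < z.Q1 := lt_of_le_of_ne (le_trans h.hQ2 h.hQ21) (Ne.symm hQ1z)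
  by_cases hP2z : z.P2 = 0
  · rw [← E3_swap]; exact E3_nonneg_of_Q1_eq_zero h.swap hP2z
  have hP2 : 0 < z.P2 := lt_of_le_of_ne (le_trans h.hP1 h.hP12) (Ne.symm hP2z)
  by_cases hP1z : z.P1 = 0
  · by_cases hQ2z : z.Q2 = 0
    · exact E3_nonneg_of_P1_Q2_eq_zero h hP1z hQ2z
    have hQ2 : 0 < z.Q2 := lt_of_le_of_ne h.hQ2 (Ne.symm hQ2z)
    by_cases hQ1o : z.Q1 = 1
    · exact E3_nonneg_of_P1_eq_zero_Q1_eq_one h hP1z hQ1o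
    exact E3_nonneg' h hQ2 (lt_of_le_of_ne h.hQ1 hQ1o) hP2
  have hP1 : 0 < z.P1 := lt_of_le_of_ne h.hP1 (Ne.symm hP1z)
  by_cases hP2o : z.P2 = 1
  · by_cases hQ2z : z.Q2 = 0
    · rw [← E3_swap]; exact E3_nonneg_of_P1_eq_zero_Q1_eq_one h.swap hQ2z hP2o
    have hQ2 : 0 < z.Q2 := lt_of_le_of_ne h.hQ2 (Ne.symm hQ2z)
    by_cases hQ1o : z.Q1 = 1
    · exact E3_nonneg_of_P2_Q1_eq_one h hP2o hQ1o
    exact E3_nonneg' h hQ2 (lt_of_le_of_ne h.hQ1 hQ1o) hP2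
  exact E3_nonneg h hP1 (lt_of_le_of_ne h.hP2 hP2o) hQ1


/-! ### The global hard-case identity H′ (= H / (1 − P₂)) and the three-case proof -/

/-- IDENTITY H′: `Q₁·E3 = (Q₁+R·Rq)κ_mu + Q₁κ_me + (Q₂+R·Rq)κ_du + R·Rq·κ_nu + Rq·E[A₁e] + Q₂·E[A₁C₁] + (Rq+Q₁Q₂)·E[A₂u] + Q₁Q₂·E[A₂e]
+ Q₁Q₂·E[A₂t] + P₁Q₁·E[GC₁] + Q₁·E[dC₂] + Q₁·a₂c₁ + Q₂·(a₁−a₂)S_e + Rq·(a₁−a₂)c₁` (`R = P₂−P₁`, `Rq = Q₁−Q₂`): every coefficient is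
nonnegative on the WHOLE parameter box; the remainder is signed exactly in the hard case `a₂ ≤ a₁`.  (`(1−P₂)·H′` is `identityH`, using
`E[A₂C₁] + E[nC₁] = (1−P₂)E[GC₁]`.)  This is the form to generalise to `K` steps. [this work] -/
theorem identityH' : z.Q1 * z.E3 =
    (z.Q1 + (z.P2 - z.P1) * (z.Q1 - z.Q2)) * (z.Smu - z.Sm * z.Su) + z.Q1 * (z.Sme - z.Sm * z.Se)
    + (z.Q2 + (z.P2 - z.P1) * (z.Q1 - z.Q2)) * (z.Sdu - z.Sd * z.Su) + (z.P2 - z.P1) * (z.Q1 - z.Q2) * (z.Snu - z.Sn * z.Su)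
    + (z.Q1 - z.Q2) * z.EA1e + z.Q2 * z.EA1C1 + ((z.Q1 - z.Q2) + z.Q1 * z.Q2) * z.EA2u + z.Q1 * z.Q2 * z.EA2e + z.Q1 * z.Q2 * z.EA2t
    + z.P1 * z.Q1 * (z.EmC1 + z.EdC1 + z.EnC1) + z.Q1 * z.EdC2
    + z.Q1 * (z.EA2 * z.EC1) + z.Q2 * ((z.EA1 - z.EA2) * z.Se) + (z.Q1 - z.Q2) * ((z.EA1 - z.EA2) * z.EC1) := by
  simp only [E3, EA1e, EA1C1, EA2u, EA2e, EA2t, EmC1, EdC1, EnC1, EdC2, EA2, EC1, EA1]; ring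

/-- Hard case, globally: `a₂ ≤ a₁` and `Q₁ > 0` ⇒ `E3 ≥ 0`, by identity H′ alone. [this work] -/
theorem E3_nonneg_of_hard (h : z.Bounds) (hQ1 : 0 < z.Q1) (ha : z.EA2 ≤ z.EA1) : 0 ≤ z.E3 := by
  have hP1 := h.hP1; have hP12 := h.hP12; have hQ2 := h.hQ2; have hQ21 := h.hQ21
  have hR : 0 ≤ z.P2 - z.P1 := by linarith
  have hRq : 0 ≤ z.Q1 - z.Q2 := by linarith
  have cmu : 0 ≤ z.Smu - z.Sm * z.Su := by linarith [h.cmu]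
  have cme : 0 ≤ z.Sme - z.Sm * z.Se := by linarith [h.cme]
  have cdu : 0 ≤ z.Sdu - z.Sd * z.Su := by linarith [h.cdu]
  have cnu : 0 ≤ z.Snu - z.Sn * z.Su := by linarith [h.cnu]
  have had : 0 ≤ z.EA1 - z.EA2 := by linarith
  have key : 0 ≤ z.Q1 * z.E3 := by
    rw [identityH']
    have := h.a1e; have := h.a1c1; have := h.a2u; have := h.a2e; have := h.a2t; have := h.c1m; have := h.c1d; have := h.c1n
    have := h.c2d; have := h.ea2; have := h.ec1; have := h.se
    have hG : 0 ≤ z.EmC1 + z.EdC1 + z.EnC1 := by linarith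
    positivity
  nlinarith [key, hQ1]

/-- **Three-case proof of `Bounds ⇒ 0 ≤ E3`**: `Q₁ = 0` (stratum Z1), `a₁ ≤ a₂` (free case), `a₂ ≤ a₁` (identity H′). [this work] -/
theorem E3_nonneg_all' (h : z.Bounds) : 0 ≤ z.E3 := by
  by_cases hQ1z : z.Q1 = 0
  · exact E3_nonneg_of_Q1_eq_zero h hQ1z
  have hQ1 : 0 < z.Q1 := lt_of_le_of_ne (le_trans h.hQ2 h.hQ21) (Ne.symm hQ1z)
  rcases le_total z.EA1 z.EA2 with ha | ha
  · exact E3_nonneg_of_EA_le h ha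
  · exact E3_nonneg_of_hard h hQ1 ha

end Atoms

end SahiTriangleStaircaseTwo

end Summit.CriticalPhenomena.PercolationContinuityZ3.Theorems
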